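import Mathlib.LinearAlgebra.BilinearForm.TensorProduct
import Mathlib.LinearAlgebra.BilinearForm.Orthogonal
import Mathlib.LinearAlgebra.PiTensorProduct.Dual
import Mathlib.RingTheory.TensorProduct.Free
import Literature.AlgebraicGeometry.Motives.MumfordTateInvariantsBaseChange
import Literature.AlgebraicGeometry.Motives.MumfordTateInvariantsTensorBasis
import HarnessLib

/-!
# The induced bilinear form on `T^{a,b}` (Mumford–Tate invariants, step 13)

For a bilinear form `B` on `W` and a bilinear form `B'` on `W^∨` (later: a polarization `Q` and
the inverse form `Q⁻¹`), the induced bilinear form on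
`T^{a,b} W = W^{⊗a} ⊗ (W^∨)^{⊗b}`,

  `tensorForm B B' a b ((⊗vₖ) ⊗ (⊗φₗ), (⊗wₖ) ⊗ (⊗ψₗ)) = ∏ₖ B(vₖ, wₖ) · ∏ₗ B'(φₗ, ψₗ)`

(`tensorForm_tmul_tprod`), built from Mathlib's `PiTensorProduct.dualDistrib` and
`LinearMap.BilinForm.tmul`. We prove: two bilinear forms on `T^{a,b}` agreeing on pure tensors are
equal (`bilinForm_ext_tprod`, finite-dimensional `W`); a similitude `g` of `B` (`B(gv, gw) =
χ B(v, w)`) whose contragredient is a similitude of `B'` acts as a similitude of the tensor form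
(`tensorForm_tensorSpaceActOver`); the orthogonal of a `g⁻¹`-stable subspace for a form of which
`g` is a similitude is `g`-stable (`apply_mem_orthogonal_of_similitude`); and the tensor form
commutes with complexification along the comparison isomorphism `hodgeTensorSpaceBaseChange`
(`tensorForm_baseChange`). This is the linear algebra behind "the orthogonal complement of an
`MT`-stable subspace for the polarization form is `MT`-stable" (Green–Griffiths–Kerr,
*Mumford–Tate groups and domains*, (I.B.6); Deligne, LNM 900, I, Prop. 3.6).

## References

* M. Green, P. Griffiths, M. Kerr, *Mumford–Tate groups and domains* (2012), (I.B.6).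
* P. Deligne, *Hodge cycles on abelian varieties*, LNM 900 (1982), I, Prop. 3.6.
-/

noncomputable section

open scoped TensorProduct
open PiTensorProduct

namespace Literature.AlgebraicGeometry.Motives

universe u v w

section Generic

variable {K : Type u} [Field K] {W : Type v} [AddCommGroup W] [Module K W]

/-- The `a`-fold tensor power of a bilinear form: `B^{⊗a}(⊗v, ⊗w) = ∏ₖ B(vₖ, wₖ)`. [folklore] -/
def piTensorForm (B : LinearMap.BilinForm K W) (a : ℕ) : LinearMap.BilinForm K (⨂[K]^a W) :=
  (PiTensorProduct.dualDistrib (R := K) (M := fun _ : Fin a => W)) ∘ₗ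
    PiTensorProduct.map fun _ : Fin a => B

/-- `B^{⊗a}` on pure tensors. [folklore] -/
@[simp]
theorem piTensorForm_tprod (B : LinearMap.BilinForm K W) {a : ℕ} (v w : Fin a → W) :
    piTensorForm B a (tprod K v) (tprod K w) = ∏ k, B (v k) (w k) := by
  simp [piTensorForm, PiTensorProduct.map_tprod, PiTensorProduct.dualDistrib_apply]

/-- **The induced bilinear form on `T^{a,b} W`** from a form `B` on `W` and a form `B'` on `W^∨`:
`B^{⊗a} ⊗ B'^{⊗b}`. [folklore] -/
def tensorForm (B : LinearMap.BilinForm K W) (B' : LinearMap.BilinForm K (Module.Dual K W))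
    (a b : ℕ) : LinearMap.BilinForm K (hodgeTensorSpaceOver K W a b) :=
  (piTensorForm B a).tmul (piTensorForm B' b)

/-- The induced form on pure tensors: `∏ₖ B(vₖ, wₖ) · ∏ₗ B'(φₗ, ψₗ)`. [folklore] -/
@[simp]
theorem tensorForm_tmul_tprod (B : LinearMap.BilinForm K W)
    (B' : LinearMap.BilinForm K (Module.Dual K W)) {a b : ℕ} (v w : Fin a → W)
    (φ ψ : Fin b → Module.Dual K W) :
    tensorForm B B' a b (tprod K v ⊗ₜ[K] tprod K φ) (tprod K w ⊗ₜ[K] tprod K ψ) =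
      (∏ k, B (v k) (w k)) * ∏ l, B' (φ l) (ψ l) := by
  simp [tensorForm, LinearMap.BilinForm.tmul, LinearMap.BilinForm.tensorDistrib_tmul, mul_comm]

variable [FiniteDimensional K W]

/-- **Two bilinear forms on `T^{a,b} W` agreeing on pure tensors are equal** (`W`
finite-dimensional: check on the tensor basis of a basis of `W`). [folklore] -/
theorem bilinForm_ext_tprod {a b : ℕ} {F₁ F₂ : LinearMap.BilinForm K (hodgeTensorSpaceOver K W a b)}
    (h : ∀ (v w : Fin a → W) (φ ψ : Fin b → Module.Dual K W),
      F₁ (tprod K v ⊗ₜ[K] tprod K φ) (tprod K w ⊗ₜ[K] tprod K ψ) =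
        F₂ (tprod K v ⊗ₜ[K] tprod K φ) (tprod K w ⊗ₜ[K] tprod K ψ)) : F₁ = F₂ := by
  classical
  refine LinearMap.BilinForm.ext_basis (hodgeTensorBasis (Module.finBasis K W) a b) fun x y => ?_
  obtain ⟨β, γ⟩ := x
  obtain ⟨β', γ'⟩ := y
  rw [hodgeTensorBasis_apply, hodgeTensorBasis_apply]
  exact h _ _ _ _

/-- **Similitudes act as similitudes of the tensor form**: if `B(gv, gw) = χ B(v, w)` and
`B'(φ ∘ g⁻¹, ψ ∘ g⁻¹) = χ' B'(φ, ψ)`, then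
`B_T(g·x, g·y) = χ^a χ'^b B_T(x, y)` on `T^{a,b}`. [folklore] -/
theorem tensorForm_tensorSpaceActOver (B : LinearMap.BilinForm K W)
    (B' : LinearMap.BilinForm K (Module.Dual K W)) {a b : ℕ} (g : W ≃ₗ[K] W) {χ χ' : K}
    (hB : ∀ v w, B (g v) (g w) = χ * B v w)
    (hB' : ∀ φ ψ : Module.Dual K W,
      B' (φ ∘ₗ (g.symm : W →ₗ[K] W)) (ψ ∘ₗ (g.symm : W →ₗ[K] W)) = χ' * B' φ ψ)
    (x y : hodgeTensorSpaceOver K W a b) :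
    tensorForm B B' a b (tensorSpaceActOver g x) (tensorSpaceActOver g y) =
      χ ^ a * χ' ^ b * tensorForm B B' a b x y := by
  suffices hF : (tensorForm B B' a b).comp (tensorSpaceActOver (a := a) (b := b) g).toLinearMap
      (tensorSpaceActOver (a := a) (b := b) g).toLinearMap = (χ ^ a * χ' ^ b) • tensorForm B B' a b from
    LinearMap.congr_fun₂ hF x y
  refine bilinForm_ext_tprod fun v w φ ψ => ?_
  simp only [LinearMap.BilinForm.comp_apply, LinearEquiv.coe_coe, tensorSpaceActOver_tmul_tprod,
    tensorForm_tmul_tprod, LinearMap.smul_apply, smul_eq_mul, hB, hB', Finset.prod_mul_distrib,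
    Finset.prod_const, Finset.card_univ, Fintype.card_fin]
  ring

omit [FiniteDimensional K W] in
/-- **The orthogonal of a stable subspace is stable under a similitude**: if
`F(g x, g y) = c F(x, y)` for all `x, y` and `g⁻¹ N ⊆ N`, then `g (N^⊥) ⊆ N^⊥`. [folklore] -/
theorem apply_mem_orthogonal_of_similitude {M : Type w} [AddCommGroup M] [Module K M]
    (F : LinearMap.BilinForm K M) (g : M ≃ₗ[K] M) {c : K} (hg : ∀ x y, F (g x) (g y) = c * F x y)
    (N : Submodule K M) (hN : ∀ x ∈ N, g.symm x ∈ N) {y : M} (hy : y ∈ F.orthogonal N) :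
    g y ∈ F.orthogonal N := by
  rw [LinearMap.BilinForm.mem_orthogonal_iff] at hy ⊢
  intro x hx
  have h := hg (g.symm x) y
  rw [LinearEquiv.apply_symm_apply] at h
  change F x (g y) = 0
  rw [h, show F (g.symm x) y = 0 from hy _ (hN x hx), mul_zero]

end Generic

/-! ### Complexification of the tensor form -/

section BaseChange

variable (V : Type u) [AddCommGroup V] [Module ℚ V] [Module.Finite ℚ V]

/-- The complexification of a bilinear form on `V^∨`, transported to `(V_ℂ)^∨` along the
comparison isomorphism `ℂ ⊗ V^∨ ≃ (V_ℂ)^∨`. [folklore] -/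
def dualFormBaseChange (B' : LinearMap.BilinForm ℚ (Module.Dual ℚ V)) :
    LinearMap.BilinForm ℂ (Module.Dual ℂ (ℂ ⊗[ℚ] V)) :=
  (B'.baseChange ℂ).comp (dualBaseChangeEquiv V).symm.toLinearMap
    (dualBaseChangeEquiv V).symm.toLinearMap

/-- The transported form on complexified functionals: `B'_ℂ(φ_ℂ, ψ_ℂ) = B'(φ, ψ)`. [folklore] -/
@[simp]
theorem dualFormBaseChange_baseChange (B' : LinearMap.BilinForm ℚ (Module.Dual ℚ V))
    (φ ψ : Module.Dual ℚ V) :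
    dualFormBaseChange V B' (Module.Dual.baseChange ℂ φ) (Module.Dual.baseChange ℂ ψ) =
      (B' φ ψ : ℂ) := by
  have hsymm : ∀ φ : Module.Dual ℚ V,
      (dualBaseChangeEquiv V).symm (Module.Dual.baseChange ℂ φ) = (1 : ℂ) ⊗ₜ[ℚ] φ := fun φ => by
    rw [LinearEquiv.symm_apply_eq, dualBaseChangeEquiv_apply, dualBaseChange_one_tmul]
  simp only [dualFormBaseChange, LinearMap.BilinForm.comp_apply, LinearEquiv.coe_coe, hsymm,
    LinearMap.BilinForm.baseChange_tmul, mul_one, Algebra.smul_def, mul_one]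
  rfl

/-- **The tensor form commutes with complexification**: along the comparison isomorphism
`ι : ℂ ⊗ T^{a,b} V ≃ T^{a,b}_ℂ V_ℂ`, `(B_T)_ℂ(x, y) = (B_ℂ)_T(ι x, ι y)`, where `(B_ℂ)_T` is the
tensor form of the complexified forms. [folklore] -/
theorem tensorForm_baseChange (B : LinearMap.BilinForm ℚ V)
    (B' : LinearMap.BilinForm ℚ (Module.Dual ℚ V)) {a b : ℕ}
    (x y : ℂ ⊗[ℚ] hodgeTensorSpace V a b) :
    (tensorForm B B' a b).baseChange ℂ x y =
      tensorForm (B.baseChange ℂ) (dualFormBaseChange V B') a b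
        (hodgeTensorSpaceBaseChange V a b x) (hodgeTensorSpaceBaseChange V a b y) := by
  classical
  suffices hF : (tensorForm B B' a b).baseChange ℂ =
      (tensorForm (B.baseChange ℂ) (dualFormBaseChange V B') a b).comp
        (hodgeTensorSpaceBaseChange V a b).toLinearMap
        (hodgeTensorSpaceBaseChange V a b).toLinearMap from
    LinearMap.congr_fun₂ hF x y
  set b₀ := hodgeTensorBasis (Module.finBasis ℚ V) a b with hb₀
  refine LinearMap.BilinForm.ext_basis (Algebra.TensorProduct.basis ℂ b₀) fun i j => ?_
  obtain ⟨β, γ⟩ := i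
  obtain ⟨β', γ'⟩ := j
  simp only [Algebra.TensorProduct.basis_apply, hb₀, hodgeTensorBasis_apply,
    LinearMap.BilinForm.baseChange_tmul, LinearMap.BilinForm.comp_apply, LinearEquiv.coe_coe,
    hodgeTensorSpaceBaseChange_tmul_tprod, one_smul, tensorForm_tmul_tprod,
    dualFormBaseChange_baseChange, mul_one, Algebra.smul_def, map_mul, map_prod, mul_one]
  rfl

end BaseChange

end Literature.AlgebraicGeometry.Motives

end
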